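import Summits.ResolutionOfSingularities.ResolutionOfSingularities.Theorems.LossDescent
import HarnessLib

/-!
# LossShearX2 — the law (L_X2), PART A: reduction to support domination between the two prepared equations of one closed point

decomp-res-lens-3, gen 28 (NODE-g28 rev 2 §6.6 F15 → §6.7).  First half of the PAIR `lawX2 : LawX2` + `lawLossEntry : LawLossEntry`
of critic letter row 220l (the +1 is the pair; this file alone is 0 by that letter and is banked by name).  PART B — support domination
PROVED line by line (one substitution identity + Lucas) and the hyp-free `lawX2 : LawX2` — is `Theorems.LossShearX2Line` (split at the
gate's 400-line lint; the two files were checked as one).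

An X2-arrow from a run state `(i, j, l ; k, m)` is the move in the chart of the FREE letter `l` translated along the loss wall `j`
(`b_u = ν e_j`, `ν ≠ 0`); its successor is the run state `(i, l, j ; k, k+m+s−q)` and `β` is then read in the frame `(l, i ; j)`.
* §1 `polyPts_succ_chart_fst_translated_virtual` — the `Ψ₍₁:₀₎`-law of `LossPolygon4` with an ARBITRARY («virtual») wall vector on
  the right: the X2 successor point set is `Ψ₍₁:₀₎` of `polyPts s r̂ l i j (clean σ_{j→l}^ν F_u)` with `r̂ = k e_i + m e_l`
  (the loss-wall mass `m` booked on the chart letter `l`).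
* §2 `ShearDom q s i j l ν g F` — SUPPORT DOMINATION: every monomial `E` of `clean σ_{j→l}^ν F` below the ceiling (`E_j < s`) has a
  partner `E'` of `clean σ_{l→j}^g F` on the same line (`E'_i = E_i`, `|E'| = |E|`) with `E'_l ≤ E_j`, and conversely.  Under it the
  `(δ, γ⁻)`-vertices of the two readings COINCIDE (`dVertexOf_eq_of_shearDom`: in skew coordinates both point sets are
  `{(N_E/d + 1, (E_i − k)/d)}` with `N_E = |E| − (k+m+s) ≥ 0`, and `d ↦ (N/d + 1, M/d)` is lex-antitone).
* §3 `runBeta_X2_le_of_shearDom` — (L_X2) at one arrow from `ShearDom` (for ANY `g`): `β' = γ⁻(Δ̂₂) = γ⁻(Δ₁) ≤ β(Δ₁) = β_u` by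
  `betaOf_image_psi10`, `gammaMinusOf_le_betaOf` and the V-lemma `betaOf_polyPts_deletePthPowers_shear` of `Theorems.LossShear`;
  `lawX2At_of_lawShearDomAt`, `lawX2_of_lawShearDom` — `LawX2 ⟸ LawShearDom` (closed forms quantified like `LawX2`);
  `noLossyStrictTailsDeep_of_lawShearDom : LawShearDom → LawLossEntry → NoLossyStrictTailsDeep`.
[CJS2020] = Cossart–Jannsen–Saito arXiv:0905.2191: Lemma 13.3's `(1:−λ)`-case is reduced there to `(1:0)` by Lemma 232 (re-choosing
`u_2`); the walk cannot re-choose coordinates and may read the same centre in the OTHER chart `l` — that reading is this file.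
-/

open MvPolynomial Finset
open Literature.AlgebraicGeometry.Resolution
open Literature.AlgebraicGeometry.Resolution.Hauser2010
open Literature.AlgebraicGeometry.Resolution.PointBlowup
open Summit.ResolutionOfSingularities.ResolutionOfSingularities.Theorems.TightDefectClasses
open Summit.ResolutionOfSingularities.ResolutionOfSingularities.Theorems.TightDefectStrongWalks
open Summit.ResolutionOfSingularities.ResolutionOfSingularities.Theorems.ItineraryCutClasses
open Summit.ResolutionOfSingularities.ResolutionOfSingularities.Theorems.BoundaryLedger
open Summit.ResolutionOfSingularities.ResolutionOfSingularities.Theorems.ProximityCut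
open Summit.ResolutionOfSingularities.ResolutionOfSingularities.Theorems.WallCut
open Summit.ResolutionOfSingularities.ResolutionOfSingularities.Theorems.LossExitCone

namespace Summit.ResolutionOfSingularities.ResolutionOfSingularities.Theorems.LossPolygon

variable {K : Type} [Field K] [DecidableEq K]
variable {q : ℕ} {s₀ : State (Fin 3) K}

/-! ## §1 The `Ψ₍₁:₀₎`-law with a virtual wall vector -/

section Virtual

variable {a b c : Fin 3}

/-- **`Ψ₍₁:₀₎`-LAW WITH A VIRTUAL WALL (PROVED).**  As `polyPts_succ_chart_fst_translated`, but the point set on the right is read with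
an ARBITRARY wall vector `r` satisfying the bookkeeping `r'_b = r_b`, `r'_a + q = s + r_a + r_b`, `r_c = r'_c = 0` against the true
successor walls `r' = r_{t+1}` — e.g. at an X2-arrow (chart of the free letter `a = l`, translation along the loss wall `c = j`)
with `r = k e_i + m e_l`. [CJS2020 Lemma 12.1 in prepared coordinates; new] -/
theorem polyPts_succ_chart_fst_translated_virtual (hs : IsRoot q s₀) (W : ForcedWalk q s₀) (t : ℕ) (hab : a ≠ b)
    (hac : a ≠ c) (hbc : b ≠ c) (hj : W.j t = a) (hb : ∀ w, w ≠ c → W.b t w = 0) {s : ℕ} {r : Fin 3 →₀ ℕ}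
    (hrb : (W.st (t + 1)).r b = r b) (hra : (W.st (t + 1)).r a + q = s + r a + r b)
    (hrc : r c = 0) (hrc' : (W.st (t + 1)).r c = 0) :
    polyPts s (W.st (t + 1)).r a b c (W.st (t + 1)).F =
      (polyPts s r a b c (deletePthPowers q (shear c a (W.b t c) (W.st t).F))).image psi10 := by
  classical
  have hH : ∀ E ∈ (shear c a (W.b t c) (W.st t).F).support, q ≤ E.degree := fun E hE => by
    obtain ⟨D, hD, hdeg⟩ := exists_degree_eq_of_mem_support_shear c a _ _ hE
    rw [hdeg]; exact le_degree_of_mem_support hs W t hD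
  unfold polyPts
  rw [support_succ_shear hs W t hac.symm hj hb, support_deletePthPowers', Finset.filter_image, Finset.image_image,
    Finset.image_image]
  set Hs := (shear c a (W.b t c) (W.st t).F).support.filter fun E => ¬ IsPthPowerExponent q E with hHs
  have hfilt : (Hs.filter fun D => chartExponent q a D c < s + (W.st (t + 1)).r c) =
      (Hs.filter fun D => D c < s + r c) := by
    refine Finset.filter_congr fun D _ => ?_
    rw [chartExponent_apply, if_neg hac.symm, hrc, hrc']
  rw [hfilt]
  refine Finset.image_congr fun D hD => ?_
  have hD := Finset.mem_filter.mp hD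
  show resPoint s (W.st (t + 1)).r a b c (chartExponent q a D) = psi10 (resPoint s r a b c D)
  have hDc : D c < s := by have h2 := hD.2; rw [hrc, add_zero] at h2; exact h2
  exact resPoint_chartExponent_fst hab hac hbc hrb hra hrc hrc' (hH D (Finset.mem_filter.mp hD.1).1) hDc

/-- The skew coordinates `(x₁ + x₂, x₂)` of the point of `E` in a frame `(a, b ; c)` with walls `r_a = m`, `r_b = k`, `r_c = 0`:
`(N/d + 1, M/d)` with `N = |E| − (k + m + s)`, `M = E_b − k`, `d = s − E_c`. [new; elementary] -/
theorem skew_resPoint_wall (hab : a ≠ b) (hac : a ≠ c) (hbc : b ≠ c) {s k m : ℕ} {r : Fin 3 →₀ ℕ} (hra : r a = m)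
    (hrb : r b = k) (hrc : r c = 0) (E : Fin 3 →₀ ℕ) (hEc : E c < s) :
    skew (resPoint s r a b c E) =
      ((((E.degree : ℕ) : ℚ) - (k + m + s)) / (((s : ℕ) : ℚ) - E c) + 1, (((E b : ℕ) : ℚ) - k) / (((s : ℕ) : ℚ) - E c)) := by
  have hd : (((s : ℕ) : ℚ) - E c) ≠ 0 := by
    rw [sub_ne_zero]; exact_mod_cast (by omega : s ≠ E c)
  have hdeg : ((E.degree : ℕ) : ℚ) = E a + E b + E c := by rw [degree_fin3 hab hac hbc E]; push_cast; ring
  simp only [skew_apply, resPoint, hra, hrb, hrc, Nat.cast_zero, add_zero, Prod.mk.injEq]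
  refine ⟨?_, trivial⟩
  rw [hdeg]
  field_simp
  ring

end Virtual

/-! ## §2 Support domination and the coincidence of the `(δ, γ⁻)`-vertices -/

section Dom

/-- Lex-antitonicity of `d ↦ (N/d + 1, M/d)` for `N, M ≥ 0`. [new; elementary] -/
theorem toLex_div_le {N M d d' : ℚ} (hN : 0 ≤ N) (hM : 0 ≤ M) (hd : 0 < d) (hdd : d ≤ d') :
    toLex ((N / d' + 1, M / d') : ℚ × ℚ) ≤ toLex ((N / d + 1, M / d) : ℚ × ℚ) := by
  rw [toLex_le_toLex_iff]
  rcases (div_le_div_of_nonneg_left hN hd hdd).lt_or_eq with h | h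
  · left
    show N / d' + 1 < N / d + 1
    linarith
  · exact Or.inr ⟨by rw [h], div_le_div_of_nonneg_left hM hd hdd⟩

/-- Two mutually dominating finite point sets have the same vertex. [folklore] -/
theorem vertexOf_eq_of_dom {A B : Finset (ℚ × ℚ)} (hA : A.Nonempty) (hB : B.Nonempty)
    (hAB : ∀ x ∈ A, ∃ y ∈ B, toLex y ≤ toLex x) (hBA : ∀ y ∈ B, ∃ x ∈ A, toLex x ≤ toLex y) :
    vertexOf A = vertexOf B := by
  obtain ⟨y, hy, hyx⟩ := hAB _ (vertexOf_mem hA)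
  obtain ⟨x, hx, hxy⟩ := hBA _ (vertexOf_mem hB)
  exact toLex_inj.mp (le_antisymm ((vertexOf_le hx).trans hxy) ((vertexOf_le hy).trans hyx))

/-- **SUPPORT DOMINATION** between the two prepared equations of a run state `(i, j, l ; k, m)` translated along the loss wall `j`
by `ν`: `σ_{j→l}^ν F` (the X2 reading: chart `l`, virtual wall) and `σ_{l→j}^g F` (the X1 reading), both cleaned.  Every monomial of
the one below its ceiling has a partner of the other on the same line `(E_i, |E|)` whose ceiling exponent is not larger.
(For `g = 1/ν` this is NODE-g28 §6.6 F15: per line both minimal admissible exponents = the root multiplicity of `u_j − ν u_l`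
in the binary form of the line, with Lucas on the `q`-excluded lines.)  OPEN as a law of the walk; see `LossEpisode.LawShearDom`. [new] -/
def ShearDom (q s : ℕ) (i j l : Fin 3) (ν g : K) (F : MvPolynomial (Fin 3) K) : Prop :=
  (∀ E ∈ (deletePthPowers q (shear j l ν F)).support, E j < s →
      ∃ E' ∈ (deletePthPowers q (shear l j g F)).support, E' i = E i ∧ E'.degree = E.degree ∧ E' l ≤ E j) ∧
  (∀ E' ∈ (deletePthPowers q (shear l j g F)).support, E' l < s →
      ∃ E ∈ (deletePthPowers q (shear j l ν F)).support, E i = E' i ∧ E.degree = E'.degree ∧ E j ≤ E' l)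

omit [DecidableEq K] in
/-- **THE `(δ, γ⁻)`-VERTICES OF THE TWO READINGS COINCIDE UNDER SUPPORT DOMINATION (PROVED).**  X2 reading: frame `(l, i ; j)`,
walls `r'` with `r'_i = k`, `r'_l = m`, `r'_j = 0`, equation `clean σ_{j→l}^ν F`; X1 reading: frame `(j, i ; l)`, walls `r` with
`r_i = k`, `r_j = m`, `r_l = 0`, equation `clean σ_{l→j}^g F`.  Hypotheses: all monomials of `F` have degree `≥ k + m + s` and
`i`-exponent `≥ k`; the X1 reading is non-empty. [NODE-g28 §6.6 F15 / K1 (iv); new] -/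
theorem dVertexOf_eq_of_shearDom {i j l : Fin 3} (hij : i ≠ j) (hli : l ≠ i) (hlj : l ≠ j) {s k m : ℕ} {ν g : K}
    {F : MvPolynomial (Fin 3) K} (hdom : ShearDom q s i j l ν g F)
    (hdeg : ∀ D ∈ F.support, k + m + s ≤ D.degree) (hki : ∀ D ∈ F.support, k ≤ D i)
    {r r' : Fin 3 →₀ ℕ} (hri : r i = k) (hrj : r j = m) (hrl : r l = 0) (hr'i : r' i = k) (hr'l : r' l = m)
    (hr'j : r' j = 0) (hne : (polyPts s r j i l (deletePthPowers q (shear l j g F))).Nonempty) :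
    (polyPts s r' l i j (deletePthPowers q (shear j l ν F))).Nonempty ∧
      dVertexOf (polyPts s r' l i j (deletePthPowers q (shear j l ν F))) =
        dVertexOf (polyPts s r j i l (deletePthPowers q (shear l j g F))) := by
  classical
  -- degree and `i`-exponent bounds on the two sheared supports
  have hS2 : ∀ E ∈ (deletePthPowers q (shear j l ν F)).support, k + m + s ≤ E.degree ∧ k ≤ E i := by
    intro E hE
    rw [support_deletePthPowers', Finset.mem_filter] at hE
    obtain ⟨D, hD, n, -, hDE⟩ := exists_shearExp_eq_of_mem_support_shear hli hlj hij ν F hE.1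
    obtain ⟨D', hD', hdegE⟩ := exists_degree_eq_of_mem_support_shear j l ν F hE.1
    refine ⟨by rw [hdegE]; exact hdeg D' hD', ?_⟩
    rw [← hDE, shearExp_apply_snd hli hij]; exact hki D hD
  have hS1 : ∀ E ∈ (deletePthPowers q (shear l j g F)).support, k + m + s ≤ E.degree ∧ k ≤ E i := by
    intro E hE
    rw [support_deletePthPowers', Finset.mem_filter] at hE
    obtain ⟨D, hD, n, -, hDE⟩ := exists_shearExp_eq_of_mem_support_shear (Ne.symm hij) (Ne.symm hlj) (Ne.symm hli) g F hE.1
    obtain ⟨D', hD', hdegE⟩ := exists_degree_eq_of_mem_support_shear l j g F hE.1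
    refine ⟨by rw [hdegE]; exact hdeg D' hD', ?_⟩
    rw [← hDE, shearExp_apply_snd (Ne.symm hij) (Ne.symm hli)]; exact hki D hD
  set P2 := polyPts s r' l i j (deletePthPowers q (shear j l ν F)) with hP2
  set P1 := polyPts s r j i l (deletePthPowers q (shear l j g F)) with hP1
  -- every point of the X1 reading is dominated by a point of the X2 reading
  have hdom1 : ∀ x ∈ P1, ∃ y ∈ P2, toLex (skew y) ≤ toLex (skew x) := by
    intro x hx
    obtain ⟨E', hE', rfl⟩ := Finset.mem_image.mp hx
    obtain ⟨hE'S, hE'l⟩ := Finset.mem_filter.mp hE'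
    rw [hrl, add_zero] at hE'l
    obtain ⟨E, hES, hEi, hEdeg, hEjl⟩ := hdom.2 E' hE'S hE'l
    have hEj : E j < s := lt_of_le_of_lt hEjl hE'l
    refine ⟨resPoint s r' l i j E,
      Finset.mem_image_of_mem _ (Finset.mem_filter.mpr ⟨hES, by rw [hr'j, add_zero]; exact hEj⟩), ?_⟩
    obtain ⟨hdegE', hkE'⟩ := hS1 E' hE'S
    rw [skew_resPoint_wall hli hlj hij hr'l hr'i hr'j E hEj,
      skew_resPoint_wall (Ne.symm hij) (Ne.symm hlj) (Ne.symm hli) hrj hri hrl E' hE'l, hEdeg, hEi]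
    refine toLex_div_le ?_ ?_ ?_ ?_
    · rw [sub_nonneg]; exact_mod_cast hdegE'
    · rw [sub_nonneg]; exact_mod_cast hkE'
    · rw [sub_pos]; exact_mod_cast hE'l
    · have : ((E j : ℕ) : ℚ) ≤ E' l := by exact_mod_cast hEjl
      linarith
  -- every point of the X2 reading is dominated by a point of the X1 reading
  have hdom2 : ∀ y ∈ P2, ∃ x ∈ P1, toLex (skew x) ≤ toLex (skew y) := by
    intro y hy
    obtain ⟨E, hE, rfl⟩ := Finset.mem_image.mp hy
    obtain ⟨hES, hEj⟩ := Finset.mem_filter.mp hE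
    rw [hr'j, add_zero] at hEj
    obtain ⟨E', hE'S, hE'i, hE'deg, hE'lj⟩ := hdom.1 E hES hEj
    have hE'l : E' l < s := lt_of_le_of_lt hE'lj hEj
    refine ⟨resPoint s r j i l E',
      Finset.mem_image_of_mem _ (Finset.mem_filter.mpr ⟨hE'S, by rw [hrl, add_zero]; exact hE'l⟩), ?_⟩
    obtain ⟨hdegE, hkE⟩ := hS2 E hES
    rw [skew_resPoint_wall hli hlj hij hr'l hr'i hr'j E hEj,
      skew_resPoint_wall (Ne.symm hij) (Ne.symm hlj) (Ne.symm hli) hrj hri hrl E' hE'l, hE'deg, hE'i]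
    refine toLex_div_le ?_ ?_ ?_ ?_
    · rw [sub_nonneg]; exact_mod_cast hdegE
    · rw [sub_nonneg]; exact_mod_cast hkE
    · rw [sub_pos]; exact_mod_cast hEj
    · have : ((E' l : ℕ) : ℚ) ≤ E j := by exact_mod_cast hE'lj
      linarith
  have hne2 : P2.Nonempty := by
    obtain ⟨x, hx⟩ := hne
    obtain ⟨y, hy, -⟩ := hdom1 x hx
    exact ⟨y, hy⟩
  refine ⟨hne2, ?_⟩
  unfold dVertexOf
  refine vertexOf_eq_of_dom (hne2.image skew) (hne.image skew) ?_ ?_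
  · intro a ha
    obtain ⟨y, hy, rfl⟩ := Finset.mem_image.mp ha
    obtain ⟨x, hx, hle⟩ := hdom2 y hy
    exact ⟨skew x, Finset.mem_image_of_mem skew hx, hle⟩
  · intro b hb
    obtain ⟨x, hx, rfl⟩ := Finset.mem_image.mp hb
    obtain ⟨y, hy, hle⟩ := hdom1 x hx
    exact ⟨skew y, Finset.mem_image_of_mem skew hy, hle⟩

omit [DecidableEq K] in
/-- … hence the same `γ⁻`. [new] -/
theorem gammaMinusOf_eq_of_shearDom {i j l : Fin 3} (hij : i ≠ j) (hli : l ≠ i) (hlj : l ≠ j) {s k m : ℕ} {ν g : K}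
    {F : MvPolynomial (Fin 3) K} (hdom : ShearDom q s i j l ν g F)
    (hdeg : ∀ D ∈ F.support, k + m + s ≤ D.degree) (hki : ∀ D ∈ F.support, k ≤ D i)
    {r r' : Fin 3 →₀ ℕ} (hri : r i = k) (hrj : r j = m) (hrl : r l = 0) (hr'i : r' i = k) (hr'l : r' l = m)
    (hr'j : r' j = 0) (hne : (polyPts s r j i l (deletePthPowers q (shear l j g F))).Nonempty) :
    gammaMinusOf (polyPts s r' l i j (deletePthPowers q (shear j l ν F))) =
      gammaMinusOf (polyPts s r j i l (deletePthPowers q (shear l j g F))) := by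
  unfold gammaMinusOf
  rw [(dVertexOf_eq_of_shearDom hij hli hlj hdom hdeg hki hri hrj hrl hr'i hr'l hr'j hne).2]

end Dom

end Summit.ResolutionOfSingularities.ResolutionOfSingularities.Theorems.LossPolygon

/-! ## §3 Run-state level: (L_X2) from support domination -/

namespace Summit.ResolutionOfSingularities.ResolutionOfSingularities.Theorems.LossEpisode

open Summit.ResolutionOfSingularities.ResolutionOfSingularities.Theorems.LossPolygon

variable {K : Type} [Field K] [DecidableEq K] {q : ℕ} {s₀ : State (Fin 3) K}

section X2

variable {W : ForcedWalk q s₀} {N s : ℕ}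

/-- **(L_X2) AT ONE ARROW FROM SUPPORT DOMINATION (PROVED).**  At an X2-arrow from a heavy run state `(i, j, l ; k, m)` on the tail
(chart `l`, `b_u = ν e_j`, `ν ≠ 0`), if the two prepared equations `clean σ_{j→l}^ν F_u` / `clean σ_{l→j}^g F_u` dominate each other
(`ShearDom`, for SOME `g`), then `β_{u+1} ≤ β_u` (read in the successor's frame `(l, i ; j)`):
`β_{u+1} = γ⁻(Δ̂₂) = γ⁻(Δ₁) ≤ β(Δ₁) = β_u`. [CJS2020 Lemma 13.3 `(1:−λ)`-case via Lemma 232, for the walk's OTHER chart; new] -/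
theorem runBeta_X2_le_of_shearDom (hroot : IsRoot q s₀) (hT : TailHyp W N s) {u : ℕ} (hNu : N ≤ u) {i j l : Fin 3}
    {k m : ℕ} (hS : IsRunState W s u i j l k m) (hm : q ≤ m + s) (hju : W.j u = l) (hbi : W.b u i = 0)
    (hS' : IsRunState W s (u + 1) i l j k (k + m + s - q)) {g : K} (hdom : ShearDom q s i j l (W.b u j) g (W.st u).F) :
    runBeta W s (u + 1) i l j ≤ runBeta W s u i j l := by
  classical
  obtain ⟨ho, hqo, -, -, -⟩ := runState_ledger hroot hT hNu hS
  obtain ⟨hri, hrj, hrl⟩ := hS.r_apply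
  obtain ⟨hri', hrl', hrj'⟩ := hS'.r_apply
  obtain ⟨hij, hli, hlj, -, -, -, -⟩ := hS
  have hbl : W.b u l = 0 := by rw [← hju]; exact W.onExc u
  have hb : ∀ w, w ≠ j → W.b u w = 0 := by
    intro w hw
    rcases fin3_eq_or i j l w hij (Ne.symm hli) (Ne.symm hlj) with h | h | h
    · subst h; exact hbi
    · exact absurd h hw
    · subst h; exact hbl
  -- the support of `F_u`: degrees `≥ k + m + s = ord F_u`, `i`-exponents `≥ k`, clean
  have hdeg : ∀ D ∈ (W.st u).F.support, k + m + s ≤ D.degree := by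
    intro D hD
    have h := ((ordZero_eq_nat_iff _ _).mp ho).2 D
    by_contra hlt
    exact (mem_support_iff.mp hD) (h (by omega))
  have hki : ∀ D ∈ (W.st u).F.support, k ≤ D i := fun D hD => by rw [← hri]; exact walk_r hroot W u D hD i
  have hraD : ∀ D ∈ (W.st u).F.support, (W.st u).r j ≤ D j := fun D hD => walk_r hroot W u D hD j
  have hclean : ∀ D ∈ (W.st u).F.support, ¬ IsPthPowerExponent q D := fun D hD =>
    not_isPthPowerExponent_of_mem_support hroot W u hD
  have hq : q ≤ s + (W.st u).r j := by rw [hrj]; omega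
  have hne : (polyPts s (W.st u).r j i l (W.st u).F).Nonempty :=
    polyPts_nonempty_of_heavy_fst hroot W u (Ne.symm hlj) i hq hrl
  have hα : alphaOf (polyPts s (W.st u).r j i l (W.st u).F) < 1 := alphaOf_polyPts_lt_one hroot W u (Ne.symm hlj) i hq hrl
  have hne₁ := polyPts_deletePthPowers_shear_nonempty (Ne.symm hij) (Ne.symm hlj) (Ne.symm hli) hrl g hraD hclean hne hα
  -- the virtual wall vector of the X2 reading
  set rv : Fin 3 →₀ ℕ := Finsupp.single i k + Finsupp.single l m with hrv
  have hrvi : rv i = k := by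
    rw [hrv, Finsupp.add_apply, Finsupp.single_eq_same, Finsupp.single_apply, if_neg hli, add_zero]
  have hrvl : rv l = m := by
    rw [hrv, Finsupp.add_apply, Finsupp.single_apply, if_neg (Ne.symm hli), Finsupp.single_eq_same, zero_add]
  have hrvj : rv j = 0 := by
    rw [hrv, Finsupp.add_apply, Finsupp.single_apply, if_neg hij, Finsupp.single_apply, if_neg hlj, add_zero]
  have hΔ := dVertexOf_eq_of_shearDom hij hli hlj hdom hdeg hki hri hrj hrl hrvi hrvl hrvj hne₁
  unfold runBeta
  rw [polyPts_succ_chart_fst_translated_virtual hroot W u hli hlj hij hju hb (r := rv) (by rw [hri', hrvi])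
      (by rw [hrl', hrvl, hrvi]; omega) hrvj hrj',
    betaOf_image_psi10 hΔ.1, gammaMinusOf_eq_of_shearDom hij hli hlj hdom hdeg hki hri hrj hrl hrvi hrvl hrvj hne₁,
    ← (betaOf_polyPts_deletePthPowers_shear (Ne.symm hij) (Ne.symm hlj) (Ne.symm hli) hrl g hraD hclean hne hα).1]
  exact gammaMinusOf_le_betaOf hne₁

/-- **LAW (L_dom), local form**: at every X2-arrow from a heavy run state `u ≥ N` of the tail, the two prepared equations dominate
each other for some `g`.  OPEN (NODE-g28 §6.6 F15, with `g = 1/ν`). [new] -/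
def LawShearDomAt (W : ForcedWalk q s₀) (N s : ℕ) : Prop :=
  ∀ u : ℕ, N ≤ u → ∀ (i j l : Fin 3) (k m : ℕ), IsRunState W s u i j l k m → q ≤ m + s →
    W.j u = l → W.b u i = 0 → W.b u j ≠ 0 → IsRunState W s (u + 1) i l j k (k + m + s - q) →
    ∃ g : K, ShearDom q s i j l (W.b u j) g (W.st u).F

/-- **(L_X2) ⟸ (L_dom) on a tail (PROVED).** [new] -/
theorem lawX2At_of_lawShearDomAt (hroot : IsRoot q s₀) (hT : TailHyp W N s) (h : LawShearDomAt W N s) : LawX2At W N s := by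
  intro u hNu i j l k m hS hm hju hbi hbj hS'
  obtain ⟨g, hdom⟩ := h u hNu i j l k m hS hm hju hbi hbj hS'
  exact runBeta_X2_le_of_shearDom hroot hT hNu hS hm hju hbi hS' hdom

end X2

/-- **LAW (L_dom), closed form** (quantified like `LawX2`). [new] -/
def LawShearDom : Prop :=
  ∀ p : ℕ, p.Prime → ∀ e : ℕ, 2 ≤ e → ∀ (K : Type) [Field K] [CharP K p] [PerfectField K] [DecidableEq K]
    (s₀ : State (Fin 3) K), IsRoot (p ^ e) s₀ → ∀ W : ForcedWalk (p ^ e) s₀, ∀ N s : ℕ, TailHyp W N s →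
    (∀ M : ℕ, ∃ t, M ≤ t ∧ W.b t ≠ 0) → (∀ (k : Fin 3) (N' : ℕ), ∃ t, N' ≤ t ∧ (W.j t = k ∨ W.b t k ≠ 0)) →
    (∀ M : ℕ, ∃ t, M ≤ t ∧ IsLossMove W t) → LawShearDomAt W N s

/-- **`LawX2 ⟸ LawShearDom` (PROVED).** [new] -/
theorem lawX2_of_lawShearDom (h : LawShearDom) : LawX2 := by
  intro p hp e he K _ _ _ _ s₀ hroot W N s hT hb hcoord hlossy
  exact lawX2At_of_lawShearDomAt hroot hT (h p hp e he K s₀ hroot W N s hT hb hcoord hlossy)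

/-- **The located residual from (L_dom) and (L_loss→entry) (PROVED assembly).** [new] -/
theorem noLossyStrictTailsDeep_of_lawShearDom (h : LawShearDom) (hL : LawLossEntry) : NoLossyStrictTailsDeep :=
  noLossyStrictTailsDeep_of_laws (lawX2_of_lawShearDom h) hL

end Summit.ResolutionOfSingularities.ResolutionOfSingularities.Theorems.LossEpisode
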